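import Literature.MathematicalPhysics.QuantumLattice.GibbsEnergyEntropyBalanceMatrixCuts
import Literature.MathematicalPhysics.QuantumLattice.InfVolFermionStateTorusLimitEnergyEntropyBalance
import HarnessLib

/-!
# Matrix energy–entropy-balance cuts of thermal torus-limit states of the `t–t'` Hubbard model

Topic `Literature/MathematicalPhysics/QuantumLattice`; torus / thermodynamic-limit packaging of
`GibbsEnergyEntropyBalanceMatrixCuts.lean` (a matrix cut
`R = Σ_{ij} Λᴬ_{ij} a_iᴴa_j + Λᴮ_{ij} a_j a_iᴴ + βΛ^C_{ij} a_iᴴ[H, a_j]` is nonnegative in every Gibbs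
eigen-mixture as soon as `Λ_A + e^{−x}Λ_B + xΛ_C ⪰ 0` for all real `x`), along the lines of
`TorusGibbsEnergyEntropyBalance.lean` / `InfVolFermionStateTorusLimitEnergyEntropyBalance.lean` (the
scalar rows): §1 unitary covariance `Uᴴ R(A, a) U = R(A, UᴴaU)` and the cut in transformed sector
mixtures; §2 the translated canonical Gibbs mixtures `(p_{L,k}, U_vψ_{L,k})` of `hubbardTorusTT' L t t' U`
on `(rectN n L, S^z = 0)` for generators commuting with `N` and `S^z`; §3 translation averages of the
embedded LOCAL cut (`Ã_i = Γ_{Λ⊆Λ₁}a_i`, `Λ₁ = thicken Λ 1`, pull-back `[H_L, ΓÃ] = Γ[H_{Λ₁}, Ã]`);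
§4 **the matrix-cut rows of thermal torus-limit states**: for every torus limit `ω` of the canonical
sector Gibbs states at inverse temperature `β`, every finite family `a_i ∈ 𝔄_Λ` conserving the local `N`
and `S^z`, and every triple with `Λ_A + e^{−x}Λ_B + xΛ_C ⪰ 0 ∀x`,
`0 ≤ Re ω(Σ_{ij} Λᴬ_{ij} Ã_iᴴÃ_j + Λᴮ_{ij} Ã_jÃ_iᴴ + βΛ^C_{ij} Ã_iᴴ(H_{Λ'}Ã_j − Ã_jH_{Λ'}))` in `Λ₁` and in every
window `Λ' ⊇ thicken Λ 1` (`IsTorusLimitOfMixture.re_expect_matrixCut_nonneg_of_sectorGibbs(_of_thicken_subset)`).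
Such a row enters the thermal window certificate of `HubbardTTPrimeThermalWindowCertificate(Symm).lean`
as an «extra row `Gₑ`» (hypothesis `0 ≤ Re ω(Gₑ)` discharged by §4); what a reader must certify per row is
the one-parameter semidefinite condition. Everything is PROVED; no definition, no named fact.

## Mathlib / tree search

REUSED: `sum_canonicalWeight_mul_re_expect_matrixCut_nonneg` (`GibbsEnergyEntropyBalanceMatrixCuts`),
`mul_apply_eq_zero_off` (`GibbsEnergyEntropyBalance`), `star_mulVec_dotProduct_mulVec_mulVec`
(`CompressedFormOnSector`), `fockTranslate_val_conjTranspose_mul_val_mul`, `…_mul_val_conjTranspose_mul`,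
`fockTranslate_apply_eq_zero_of_szConfig`, `fockTranslate_val_conjTranspose_eq_neg`,
`apply_eq_zero_of_szConfig_of_commute`, `conjTranspose_apply_eq_zero_of_szConfig_of_commute`
(`TorusGibbsEnergyEntropyBalance`), `hubbardTorusTT'_commutator_fermionEmbed`,
`commute_fermionEmbed_toTorusEmb_totalNumber/spinZ`, `torusAvgExpectAt_of_injOn`,
`eventually_injOn_proj_of_tendsto`, `hubbardTTPrime_localHamiltonian_commutator_fermionEmbed_eq`,
`InfVolFermionState.compatible`. No matrix-cut rows in the tree before (`lean search 'matrixCut'`, 2026-08-26).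

## References

* H. Fawzi, O. Fawzi, S. O. Scalet, Nat. Commun. 15 (2024) 7394 = arXiv:2311.18706, §3.2 Thm. 3.4, (opt2).
  [cite: FawziFawziScalet2024, Thm. 3.4]
* O. Bratteli, D. W. Robinson, *OAQSM 2* (1997), Thm. 5.3.15, Thm. 6.2.4. [cite: BratteliRobinsonII1997, Thm. 5.3.15]
-/

noncomputable section

namespace Literature.MathematicalPhysics.QuantumLattice

open Matrix Finset HubbardWave0 Literature.Probability.LatticeModels ThermodynamicLimit
open _root_.Filter
open scoped _root_.Topology ComplexOrder BigOperators

/-! ### §1 Unitary covariance of matrix cuts -/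

section Covariance

variable {ι : Type*} [Fintype ι] [DecidableEq ι]
variable {m : Type*} [Fintype m]

omit [DecidableEq ι] in
/-- **Unitary covariance of a matrix cut**: for `U` with `Uᴴ(UX) = X = U(UᴴX)` commuting with `A`,
`Uᴴ R(A, a) U = R(A, UᴴaU)` for the matrix cut `R(A, a) = Σ_{ij} Λᴬ_{ij} a_iᴴ a_j + Λᴮ_{ij} a_j a_iᴴ
+ β Λ^C_{ij} a_iᴴ (A a_j − a_j A)`. [cite: FawziFawziScalet2024, Thm. 3.4] -/
theorem conjTranspose_mul_matrixCut_mul_of_commute {U A : Matrix ι ι ℂ} (hU : ∀ X : Matrix ι ι ℂ, Uᴴ * (U * X) = X)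
    (hU' : ∀ X : Matrix ι ι ℂ, U * (Uᴴ * X) = X) (hUA : Commute U A) (a : m → Matrix ι ι ℂ) (β : ℝ)
    (ΛA ΛB ΛC : Matrix m m ℂ) :
    Uᴴ * (∑ i, ∑ j, (ΛA i j • ((a i)ᴴ * a j) + ΛB i j • (a j * (a i)ᴴ) +
        ((β : ℝ) : ℂ) • (ΛC i j • ((a i)ᴴ * (A * a j - a j * A))))) * U =
      ∑ i, ∑ j, (ΛA i j • ((Uᴴ * a i * U)ᴴ * (Uᴴ * a j * U)) + ΛB i j • ((Uᴴ * a j * U) * (Uᴴ * a i * U)ᴴ) +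
        ((β : ℝ) : ℂ) • (ΛC i j • ((Uᴴ * a i * U)ᴴ * (A * (Uᴴ * a j * U) - (Uᴴ * a j * U) * A)))) := by
  have hconj : ∀ Y Z : Matrix ι ι ℂ, Uᴴ * (Y * Z) * U = (Uᴴ * Y * U) * (Uᴴ * Z * U) := by
    intro Y Z
    calc Uᴴ * (Y * Z) * U = Uᴴ * Y * (Z * U) := by simp only [Matrix.mul_assoc]
      _ = Uᴴ * Y * (U * (Uᴴ * (Z * U))) := by rw [hU']
      _ = (Uᴴ * Y * U) * (Uᴴ * Z * U) := by simp only [Matrix.mul_assoc]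
  have hA : Uᴴ * A * U = A := by
    rw [Matrix.mul_assoc, ← hUA.eq, hU]
  have hat : ∀ i, (Uᴴ * a i * U)ᴴ = Uᴴ * (a i)ᴴ * U := fun i => by
    rw [conjTranspose_mul, conjTranspose_mul, conjTranspose_conjTranspose, Matrix.mul_assoc]
  rw [Matrix.mul_sum, Matrix.sum_mul]
  refine Finset.sum_congr rfl fun i _ => ?_
  rw [Matrix.mul_sum, Matrix.sum_mul]
  refine Finset.sum_congr rfl fun j _ => ?_
  simp only [hat, Matrix.mul_add, Matrix.mul_sub, Matrix.add_mul, Matrix.sub_mul, Matrix.mul_smul,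
    Matrix.smul_mul, hconj, hA]

variable (p : ι → Prop) [DecidablePred p]

/-- **Matrix cuts for unitarily transformed canonical sector eigen-mixtures**: under the hypotheses of
`sum_canonicalWeight_mul_re_expect_matrixCut_nonneg`, if `U` satisfies `Uᴴ(UX) = X = U(UᴴX)`,
commutes with `A`, and `U`, `Uᴴ` preserve the sector, the mixture `(w_c, Uψ_c)` satisfies the same
inequality (covariance: it is the cut of the sector-preserving generators `Uᴴ a_i U`).
[cite: FawziFawziScalet2024, Thm. 3.4] -/
theorem sum_canonicalWeight_mul_re_expect_matrixCut_mulVec_nonneg {A : Matrix ι ι ℂ} (hA : A.IsHermitian)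
    (hinv : ∀ i j, ¬ p i → p j → A i j = 0) {U : Matrix ι ι ℂ} (hU : ∀ X : Matrix ι ι ℂ, Uᴴ * (U * X) = X)
    (hU' : ∀ X : Matrix ι ι ℂ, U * (Uᴴ * X) = X) (hUA : Commute U A)
    (hUp : ∀ i j, ¬ p i → p j → U i j = 0) (hUp' : ∀ i j, ¬ p i → p j → Uᴴ i j = 0)
    {a : m → Matrix ι ι ℂ} (ha : ∀ k i j, ¬ p i → p j → a k i j = 0)
    (ha' : ∀ k i j, ¬ p i → p j → (a k)ᴴ i j = 0) (β : ℝ) {ΛA ΛB ΛC : Matrix m m ℂ}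
    (hPSD : ∀ x : ℝ, (ΛA + ((Real.exp (-x) : ℝ) : ℂ) • ΛB + ((x : ℝ) : ℂ) • ΛC).PosSemidef) :
    0 ≤ ∑ c, canonicalWeight β (sectorEigenvalue p A hA) c *
      (star (U *ᵥ sectorEigenvector p A hA c) ⬝ᵥ
        ((∑ i, ∑ j, (ΛA i j • ((a i)ᴴ * a j) + ΛB i j • (a j * (a i)ᴴ) +
            ((β : ℝ) : ℂ) • (ΛC i j • ((a i)ᴴ * (A * a j - a j * A))))) *ᵥ (U *ᵥ sectorEigenvector p A hA c))).re := by
  have hb : ∀ k i j, ¬ p i → p j → (Uᴴ * a k * U) i j = 0 := fun k =>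
    mul_apply_eq_zero_off p (mul_apply_eq_zero_off p hUp' (ha k)) hUp
  have hb' : ∀ k i j, ¬ p i → p j → (Uᴴ * a k * U)ᴴ i j = 0 := fun k => by
    have h : (Uᴴ * a k * U)ᴴ = Uᴴ * (a k)ᴴ * U := by
      rw [conjTranspose_mul, conjTranspose_mul, conjTranspose_conjTranspose, Matrix.mul_assoc]
    rw [h]
    exact mul_apply_eq_zero_off p (mul_apply_eq_zero_off p hUp' (ha' k)) hUp
  refine (sum_canonicalWeight_mul_re_expect_matrixCut_nonneg p hA hinv hb hb' β hPSD).trans_eq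
    (Finset.sum_congr rfl fun c _ => ?_)
  rw [star_mulVec_dotProduct_mulVec_mulVec U _ (sectorEigenvector p A hA c) (sectorEigenvector p A hA c),
    conjTranspose_mul_matrixCut_mul_of_commute hU hU' hUA a β ΛA ΛB ΛC]

end Covariance

/-! ### §2 The translated canonical Gibbs mixtures of the `t–t'` torus -/

section Torus

variable (L : ℕ) [NeZero L] {m : Type*} [Fintype m]

/-- **Matrix cuts in the translated canonical Gibbs mixtures of the torus**: for
`H_L = hubbardTorusTT' L t t' U`, the canonical Gibbs data of `(rectN n L, S^z = 0)`, a translation `v`,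
generators `b_i` commuting with `N` and `S^z`, and `Λ_A + e^{−x}Λ_B + xΛ_C ⪰ 0` for all `x`:
`0 ≤ Σ_k p_{L,k} Re⟨U_vψ_{L,k}, R(H_L, b) U_vψ_{L,k}⟩`. [cite: FawziFawziScalet2024, Thm. 3.4] -/
theorem sum_sectorGibbsWeightTT'_mul_re_expect_matrixCut_fockTranslate_nonneg (t t' U n β : ℝ)
    (v : TorusSite 2 L) {b : m → Matrix (Finset (Orb (FermionTorus 2 L))) (Finset (Orb (FermionTorus 2 L))) ℂ}
    (hbN : ∀ i, Commute (b i) totalNumber) (hbS : ∀ i, Commute (b i) HubbardWave0.spinZ)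
    {ΛA ΛB ΛC : Matrix m m ℂ}
    (hPSD : ∀ x : ℝ, (ΛA + ((Real.exp (-x) : ℝ) : ℂ) • ΛB + ((x : ℝ) : ℂ) • ΛC).PosSemidef) :
    0 ≤ ∑ k, sectorGibbsWeightTT' β t t' U n L k *
      (star ((fockTranslate v).val *ᵥ sectorGibbsVectorTT' t t' U n L k) ⬝ᵥ
        ((∑ i, ∑ j, (ΛA i j • ((b i)ᴴ * b j) + ΛB i j • (b j * (b i)ᴴ) +
            ((β : ℝ) : ℂ) • (ΛC i j • ((b i)ᴴ * (hubbardTorusTT' L t t' U * b j - b j * hubbardTorusTT' L t t' U))))) *ᵥ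
          ((fockTranslate v).val *ᵥ sectorGibbsVectorTT' t t' U n L k))).re := by
  set H := hubbardTorusTT' L t t' U with hH
  have hA : H.IsHermitian := hubbardTorusTT'_isHermitian L t t' U
  have hinv : ∀ s s', ¬ szConfig n L s → szConfig n L s' → H s s' = 0 :=
    fun s s' hs hs' => hubbardTorusTT'_apply_eq_zero_of_szConfig L t t' U n s s' hs hs'
  have hUp' : ∀ s s', ¬ szConfig n L s → szConfig n L s' → (fockTranslate v).valᴴ s s' = 0 := by
    intro s s' hs hs'
    rw [fockTranslate_val_conjTranspose_eq_neg]
    exact fockTranslate_apply_eq_zero_of_szConfig L (-v) n s s' hs hs'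
  have key := sum_canonicalWeight_mul_re_expect_matrixCut_mulVec_nonneg (szConfig n L) hA hinv
    (fockTranslate_val_conjTranspose_mul_val_mul L v) (fockTranslate_val_mul_val_conjTranspose_mul L v)
    (fockTranslate_commute_hubbardTorusTT' L v t t' U)
    (fun s s' hs hs' => fockTranslate_apply_eq_zero_of_szConfig L v n s s' hs hs') hUp'
    (fun i => apply_eq_zero_of_szConfig_of_commute L n (hbN i) (hbS i))
    (fun i => conjTranspose_apply_eq_zero_of_szConfig_of_commute L n (hbN i) (hbS i)) β hPSD
  set e := sectorGibbsIndex n L with he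
  refine key.trans_eq ?_
  rw [← Equiv.sum_comp e]
  refine Finset.sum_congr rfl fun k _ => ?_
  have hw : sectorGibbsWeightTT' β t t' U n L k = canonicalWeight β (sectorEigenvalue (szConfig n L) H hA) (e k) := by
    rw [sectorGibbsWeightTT', show sectorGibbsEnergyTT' t t' U n L =
      sectorEigenvalue (szConfig n L) H hA ∘ e from rfl]
    unfold canonicalWeight
    rw [show (∑ b', Real.exp (-(β * (sectorEigenvalue (szConfig n L) H hA ∘ e) b'))) =
      ∑ b', Real.exp (-(β * sectorEigenvalue (szConfig n L) H hA b')) from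
      Equiv.sum_comp e (fun b' => Real.exp (-(β * sectorEigenvalue (szConfig n L) H hA b')))]
    rfl
  rw [hw]
  rfl

end Torus

/-! ### §3 Translation averages of the embedded local matrix cuts -/

section TorusAverage

variable (L : ℕ) [NeZero L] (t t' U : ℝ) {m : Type*} [Fintype m]

/-- **The matrix-cut row of local generators, averaged over the torus translations, is nonnegative in
the canonical Gibbs mixture.** For `x ↦ x mod L` injective on `thicken (thicken Λ 1) 1`, generators
`a_i ∈ 𝔄_Λ` conserving the local `N` and `S^z`, `Λ₁ = thicken Λ 1`, `Ã_i = Γ_{Λ⊆Λ₁} a_i`, the local cut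
`R_loc = Σ_{ij} Λᴬ_{ij} Ã_iᴴÃ_j + Λᴮ_{ij} Ã_jÃ_iᴴ + βΛ^C_{ij} Ã_iᴴ(H_{Λ₁}Ã_j − Ã_jH_{Λ₁})` with
`Λ_A + e^{−x}Λ_B + xΛ_C ⪰ 0` for all `x` satisfies `0 ≤ Re Σ_k p_{L,k} torusAvgExpectAt L Λ₁ R_loc ψ_{L,k}`.
[cite: FawziFawziScalet2024, Thm. 3.4] -/
theorem re_sum_sectorGibbsWeightTT'_mul_torusAvgExpectAt_matrixCut_nonneg (n β : ℝ) {Λ : Finset (Site 2)}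
    (hInj : Set.InjOn (Torus.proj (d := 2) L) ↑(thicken (thicken Λ 1) 1))
    {a : m → FermionOp Λ} (haN : ∀ i, Commute (a i) totalNumber) (haS : ∀ i, Commute (a i) HubbardWave0.spinZ)
    {ΛA ΛB ΛC : Matrix m m ℂ}
    (hPSD : ∀ x : ℝ, (ΛA + ((Real.exp (-x) : ℝ) : ℂ) • ΛB + ((x : ℝ) : ℂ) • ΛC).PosSemidef) :
    0 ≤ (∑ k, (sectorGibbsWeightTT' β t t' U n L k : ℂ) *
      torusAvgExpectAt L (thicken Λ 1)
        (∑ i, ∑ j, (ΛA i j • ((fermionEmbed (PolySite.incl (subset_thicken Λ 1)) (a i))ᴴ *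
            fermionEmbed (PolySite.incl (subset_thicken Λ 1)) (a j)) +
          ΛB i j • (fermionEmbed (PolySite.incl (subset_thicken Λ 1)) (a j) *
            (fermionEmbed (PolySite.incl (subset_thicken Λ 1)) (a i))ᴴ) +
          ((β : ℝ) : ℂ) • (ΛC i j • ((fermionEmbed (PolySite.incl (subset_thicken Λ 1)) (a i))ᴴ *
            ((hubbardTTPrimeFermionInteraction t t' U).localHamiltonian (thicken Λ 1) *
                fermionEmbed (PolySite.incl (subset_thicken Λ 1)) (a j) -
              fermionEmbed (PolySite.incl (subset_thicken Λ 1)) (a j) *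
                (hubbardTTPrimeFermionInteraction t t' U).localHamiltonian (thicken Λ 1))))))
        (sectorGibbsVectorTT' t t' U n L k)).re := by
  have h₁ : Set.InjOn (Torus.proj (d := 2) L) ↑(thicken Λ 1) :=
    hInj.mono (by exact_mod_cast subset_thicken (thicken Λ 1) 1)
  have hΛ' : Set.InjOn (Torus.proj (d := 2) L) ↑Λ :=
    hInj.mono (by exact_mod_cast (subset_thicken Λ 1).trans (subset_thicken (thicken Λ 1) 1))
  -- the embedded generators on the torus
  set b : m → Matrix (Finset (Orb (FermionTorus 2 L))) (Finset (Orb (FermionTorus 2 L))) ℂ :=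
    fun i => fermionEmbed (PolySite.toTorusEmb L hΛ') (a i) with hbdef
  have hb : ∀ i, fermionEmbed (PolySite.toTorusEmb L h₁) (fermionEmbed (PolySite.incl (subset_thicken Λ 1)) (a i)) = b i := by
    intro i
    rw [hbdef]
    dsimp only
    rw [fermionEmbed_fermionEmbed]
    exact congrFun (congrArg DFunLike.coe (fermionEmbed_congr fun q => rfl)) (a i)
  have hbN : ∀ i, Commute (b i) totalNumber := fun i => commute_fermionEmbed_toTorusEmb_totalNumber L hΛ' (haN i)
  have hbS : ∀ i, Commute (b i) HubbardWave0.spinZ := fun i => commute_fermionEmbed_toTorusEmb_spinZ L hΛ' (haS i)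
  -- pull the cut back into the torus
  have hΓ : fermionEmbed (PolySite.toTorusEmb L h₁)
      (∑ i, ∑ j, (ΛA i j • ((fermionEmbed (PolySite.incl (subset_thicken Λ 1)) (a i))ᴴ *
            fermionEmbed (PolySite.incl (subset_thicken Λ 1)) (a j)) +
          ΛB i j • (fermionEmbed (PolySite.incl (subset_thicken Λ 1)) (a j) *
            (fermionEmbed (PolySite.incl (subset_thicken Λ 1)) (a i))ᴴ) +
          ((β : ℝ) : ℂ) • (ΛC i j • ((fermionEmbed (PolySite.incl (subset_thicken Λ 1)) (a i))ᴴ *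
            ((hubbardTTPrimeFermionInteraction t t' U).localHamiltonian (thicken Λ 1) *
                fermionEmbed (PolySite.incl (subset_thicken Λ 1)) (a j) -
              fermionEmbed (PolySite.incl (subset_thicken Λ 1)) (a j) *
                (hubbardTTPrimeFermionInteraction t t' U).localHamiltonian (thicken Λ 1)))))) =
      ∑ i, ∑ j, (ΛA i j • ((b i)ᴴ * b j) + ΛB i j • (b j * (b i)ᴴ) +
        ((β : ℝ) : ℂ) • (ΛC i j • ((b i)ᴴ * (hubbardTorusTT' L t t' U * b j - b j * hubbardTorusTT' L t t' U)))) := by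
    rw [fermionEmbed_sum]
    refine Finset.sum_congr rfl fun i _ => ?_
    rw [fermionEmbed_sum]
    refine Finset.sum_congr rfl fun j _ => ?_
    rw [fermionEmbed_add, fermionEmbed_add, fermionEmbed_smul, fermionEmbed_smul, fermionEmbed_smul,
      fermionEmbed_smul, fermionEmbed_mul, fermionEmbed_mul, fermionEmbed_mul, fermionEmbed_conjTranspose,
      ← hubbardTorusTT'_commutator_fermionEmbed L t t' U (subset_thicken Λ 1) subset_rfl hInj (a j), hb, hb]
  -- each translate is nonnegative
  have hv : ∀ v : TorusSite 2 L, 0 ≤ ∑ k, sectorGibbsWeightTT' β t t' U n L k *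
      (expect (∑ i, ∑ j, (ΛA i j • ((b i)ᴴ * b j) + ΛB i j • (b j * (b i)ᴴ) +
        ((β : ℝ) : ℂ) • (ΛC i j • ((b i)ᴴ * (hubbardTorusTT' L t t' U * b j - b j * hubbardTorusTT' L t t' U)))))
        ((fockTranslate v).val *ᵥ sectorGibbsVectorTT' t t' U n L k)).re := fun v =>
    sum_sectorGibbsWeightTT'_mul_re_expect_matrixCut_fockTranslate_nonneg L t t' U n β v hbN hbS hPSD
  have hcast : ((Fintype.card (TorusSite 2 L) : ℂ))⁻¹ = (((Fintype.card (TorusSite 2 L) : ℝ)⁻¹ : ℝ) : ℂ) := by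
    push_cast; rfl
  simp_rw [torusAvgExpectAt_of_injOn L h₁, hΓ]
  rw [Complex.re_sum]
  simp_rw [hcast, ← mul_assoc, ← Complex.ofReal_mul, Complex.re_ofReal_mul, Complex.re_sum, Finset.mul_sum]
  rw [Finset.sum_comm]
  refine Finset.sum_nonneg fun v _ => ?_
  have hfac : ∀ (g : Fin (sectorGibbsCount n L) → ℝ),
      ∑ k, sectorGibbsWeightTT' β t t' U n L k * (Fintype.card (TorusSite 2 L) : ℝ)⁻¹ * g k =
        (Fintype.card (TorusSite 2 L) : ℝ)⁻¹ * ∑ k, sectorGibbsWeightTT' β t t' U n L k * g k := by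
    intro g
    rw [Finset.mul_sum]
    exact Finset.sum_congr rfl fun k _ => by ring
  rw [hfac]
  exact mul_nonneg (inv_nonneg.2 (Nat.cast_nonneg _)) (hv v)

end TorusAverage

/-! ### §4 Matrix-cut rows of thermal torus-limit states -/

namespace InfVolFermionState

variable {m : Type*} [Fintype m]

/-- **Matrix energy–entropy-balance rows of thermal torus limits.** Let `ω` be a torus limit of the
canonical Gibbs states of `hubbardTorusTT' (Ls j) t t' U` at inverse temperature `β` on the sectors
`(rectN n (Ls j), S^z = 0)` along `Ls → ∞`. Then for every region `Λ`, every finite family of local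
generators `a_i ∈ 𝔄_Λ` conserving the local particle number and `S^z`, and every triple
`Λ_A, Λ_B, Λ_C` with `Λ_A + e^{−x}Λ_B + xΛ_C ⪰ 0` for all real `x`:
`0 ≤ Re ω_{Λ₁}(Σ_{ij} Λᴬ_{ij} Ã_iᴴÃ_j + Λᴮ_{ij} Ã_jÃ_iᴴ + βΛ^C_{ij} Ã_iᴴ(H^{tt'}_{Λ₁}Ã_j − Ã_jH^{tt'}_{Λ₁}))`,
`Λ₁ = thicken Λ 1`, `Ã_i = Γ_{Λ⊆Λ₁} a_i` — the MATRIX cuts (dual rows of Fawzi–Fawzi–Scalet's matrix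
energy–entropy-balance constraint) hold for thermal torus limits with gauge-invariant generators.
[cite: FawziFawziScalet2024, Thm. 3.4] -/
theorem IsTorusLimitOfMixture.re_expect_matrixCut_nonneg_of_sectorGibbs
    (t t' U : ℝ) {n : ℝ} (β : ℝ) {ω : InfVolFermionState 2} {Ls : ℕ → ℕ}
    (h : ω.IsTorusLimitOfMixture (sectorGibbsCount n) (fun L => sectorGibbsWeightTT' β t t' U n L)
      (fun L => sectorGibbsVectorTT' t t' U n L) Ls)
    (hLs : Tendsto Ls atTop atTop) {Λ : Finset (Site 2)} {a : m → FermionOp Λ}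
    (haN : ∀ i, Commute (a i) totalNumber) (haS : ∀ i, Commute (a i) HubbardWave0.spinZ)
    {ΛA ΛB ΛC : Matrix m m ℂ}
    (hPSD : ∀ x : ℝ, (ΛA + ((Real.exp (-x) : ℝ) : ℂ) • ΛB + ((x : ℝ) : ℂ) • ΛC).PosSemidef) :
    0 ≤ (ω.expect (thicken Λ 1)
      (∑ i, ∑ j, (ΛA i j • ((fermionEmbed (PolySite.incl (subset_thicken Λ 1)) (a i))ᴴ *
            fermionEmbed (PolySite.incl (subset_thicken Λ 1)) (a j)) +
          ΛB i j • (fermionEmbed (PolySite.incl (subset_thicken Λ 1)) (a j) *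
            (fermionEmbed (PolySite.incl (subset_thicken Λ 1)) (a i))ᴴ) +
          ((β : ℝ) : ℂ) • (ΛC i j • ((fermionEmbed (PolySite.incl (subset_thicken Λ 1)) (a i))ᴴ *
            ((hubbardTTPrimeFermionInteraction t t' U).localHamiltonian (thicken Λ 1) *
                fermionEmbed (PolySite.incl (subset_thicken Λ 1)) (a j) -
              fermionEmbed (PolySite.incl (subset_thicken Λ 1)) (a j) *
                (hubbardTTPrimeFermionInteraction t t' U).localHamiltonian (thicken Λ 1))))))).re := by
  refine ge_of_tendsto ((Complex.continuous_re.tendsto _).comp (h (thicken Λ 1) _)) ?_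
  filter_upwards [eventually_injOn_proj_of_tendsto (thicken (thicken Λ 1) 1) hLs, hLs.eventually_ge_atTop 1]
    with j hInj hj
  haveI : NeZero (Ls j) := ⟨by omega⟩
  rw [Function.comp_apply]
  simp_rw [torusAvgExpect_eq]
  exact re_sum_sectorGibbsWeightTT'_mul_torusAvgExpectAt_matrixCut_nonneg (Ls j) t t' U n β hInj haN haS hPSD

/-- **The matrix-cut rows in an arbitrary window** `Λ' ⊇ thicken Λ 1`, written with `H^{tt'}_{Λ'}` and
`Γ = Γ_{Λ⊆Λ'}` (locality of the commutator, `hubbardTTPrime_localHamiltonian_commutator_fermionEmbed_eq`, and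
compatibility) — the shape in which a thermal certificate carries an «eeb-mat» row as an extra row `G_e`
of `HubbardTTPrimeThermalWindowCertificate(Symm).lean`. [cite: FawziFawziScalet2024, Thm. 3.4] -/
theorem IsTorusLimitOfMixture.re_expect_matrixCut_nonneg_of_sectorGibbs_of_thicken_subset
    (t t' U : ℝ) {n : ℝ} (β : ℝ) {ω : InfVolFermionState 2} {Ls : ℕ → ℕ}
    (h : ω.IsTorusLimitOfMixture (sectorGibbsCount n) (fun L => sectorGibbsWeightTT' β t t' U n L)
      (fun L => sectorGibbsVectorTT' t t' U n L) Ls)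
    (hLs : Tendsto Ls atTop atTop) {Λ Λ' : Finset (Site 2)} (hΛ : Λ ⊆ Λ') (h8 : thicken Λ 1 ⊆ Λ')
    {a : m → FermionOp Λ} (haN : ∀ i, Commute (a i) totalNumber) (haS : ∀ i, Commute (a i) HubbardWave0.spinZ)
    {ΛA ΛB ΛC : Matrix m m ℂ}
    (hPSD : ∀ x : ℝ, (ΛA + ((Real.exp (-x) : ℝ) : ℂ) • ΛB + ((x : ℝ) : ℂ) • ΛC).PosSemidef) :
    0 ≤ (ω.expect Λ'
      (∑ i, ∑ j, (ΛA i j • ((fermionEmbed (PolySite.incl hΛ) (a i))ᴴ * fermionEmbed (PolySite.incl hΛ) (a j)) +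
          ΛB i j • (fermionEmbed (PolySite.incl hΛ) (a j) * (fermionEmbed (PolySite.incl hΛ) (a i))ᴴ) +
          ((β : ℝ) : ℂ) • (ΛC i j • ((fermionEmbed (PolySite.incl hΛ) (a i))ᴴ *
            ((hubbardTTPrimeFermionInteraction t t' U).localHamiltonian Λ' * fermionEmbed (PolySite.incl hΛ) (a j) -
              fermionEmbed (PolySite.incl hΛ) (a j) * (hubbardTTPrimeFermionInteraction t t' U).localHamiltonian Λ')))))).re := by
  have hemb : ∀ i, fermionEmbed (PolySite.incl hΛ) (a i) =
      fermionEmbed (PolySite.incl h8) (fermionEmbed (PolySite.incl (subset_thicken Λ 1)) (a i)) := fun i => by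
    rw [fermionEmbed_fermionEmbed, PolySite.incl_trans]
  have hrow : (∑ i, ∑ j, (ΛA i j • ((fermionEmbed (PolySite.incl hΛ) (a i))ᴴ * fermionEmbed (PolySite.incl hΛ) (a j)) +
          ΛB i j • (fermionEmbed (PolySite.incl hΛ) (a j) * (fermionEmbed (PolySite.incl hΛ) (a i))ᴴ) +
          ((β : ℝ) : ℂ) • (ΛC i j • ((fermionEmbed (PolySite.incl hΛ) (a i))ᴴ *
            ((hubbardTTPrimeFermionInteraction t t' U).localHamiltonian Λ' * fermionEmbed (PolySite.incl hΛ) (a j) -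
              fermionEmbed (PolySite.incl hΛ) (a j) * (hubbardTTPrimeFermionInteraction t t' U).localHamiltonian Λ'))))) =
      fermionEmbed (PolySite.incl h8)
        (∑ i, ∑ j, (ΛA i j • ((fermionEmbed (PolySite.incl (subset_thicken Λ 1)) (a i))ᴴ *
            fermionEmbed (PolySite.incl (subset_thicken Λ 1)) (a j)) +
          ΛB i j • (fermionEmbed (PolySite.incl (subset_thicken Λ 1)) (a j) *
            (fermionEmbed (PolySite.incl (subset_thicken Λ 1)) (a i))ᴴ) +
          ((β : ℝ) : ℂ) • (ΛC i j • ((fermionEmbed (PolySite.incl (subset_thicken Λ 1)) (a i))ᴴ *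
            ((hubbardTTPrimeFermionInteraction t t' U).localHamiltonian (thicken Λ 1) *
                fermionEmbed (PolySite.incl (subset_thicken Λ 1)) (a j) -
              fermionEmbed (PolySite.incl (subset_thicken Λ 1)) (a j) *
                (hubbardTTPrimeFermionInteraction t t' U).localHamiltonian (thicken Λ 1)))))) := by
    rw [fermionEmbed_sum]
    refine Finset.sum_congr rfl fun i _ => ?_
    rw [fermionEmbed_sum]
    refine Finset.sum_congr rfl fun j _ => ?_
    rw [hubbardTTPrime_localHamiltonian_commutator_fermionEmbed_eq t t' U hΛ h8 (a j), hemb, hemb,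
      fermionEmbed_add, fermionEmbed_add, fermionEmbed_smul, fermionEmbed_smul, fermionEmbed_smul, fermionEmbed_smul,
      fermionEmbed_mul, fermionEmbed_mul, fermionEmbed_mul, fermionEmbed_conjTranspose]
  rw [hrow, ω.compatible h8]
  exact h.re_expect_matrixCut_nonneg_of_sectorGibbs t t' U β hLs haN haS hPSD

end InfVolFermionState

end Literature.MathematicalPhysics.QuantumLattice

end
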